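import Summits.BirchSwinnertonDyer.Rank1Residual.F1Sign2.UnitLocusAtTwo
import Literature.NumberTheory.EllipticCurves.PerrinRiou2003.RankZeroSupersingularUpperBound
import Literature.NumberTheory.EllipticCurves.AnomalousOfRationalTorsionProofs
import Summits.BirchSwinnertonDyer.Rank1Residual.P2.EmptyCellsAtTwo
import HarnessLib

/-!
# Cell `bsd-f1-sign2` (`p = 2`, non-CM) — candidate ES-C-E `KatoRankZeroUpperBoundAtTwo`: Perrin-Riou 2003
# Prop. 4.8 (Kato's rank-`0` upper bound WITH Tamagawa numbers at a good supersingular prime) READ AT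
# `p = 2` — SIGN-FREE (no ♯/♭/± object), all three traces; typed candidate of the Euler-system lens

HONEST FRAMING (typer seat `bsd-f1-sign2-ty`; HOME `run/shared/lean/pub/bsd-f1-sign2/`, CANDIDATES.md §2
row ES-C-E): STATEMENT ONLY — one `@[conjecture] def` (OPEN obligation at `p = 2`, ours: the tree's named
fact `PerrinRiou2003.prop48_padicValRat_bsd_rank_zero_le` carries `_hp : p ≠ 2`, "Kato's clause and
Perrin-Riou's local theory are for odd `p`"), re-filed VERBATIM from `HOME/data-es/Sketch.lean`
bcb79e6976fcc0bd together with its two PROVED bookkeeping theorems; nothing asserted, nothing booked, no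
named fact, PARTITION: none moved. REFUTER PASS: REF1-AUDIT-v1.md §1 — **SURVIVES (verbatim PR 4.8 at
`p := 2`)**: byte-match with the named fact minus `_hp`; `Kato2004.ImageContainsSL2 W 2 ⟺ ∀ n,
HasSurjectiveModNGaloisRep (2^n)` = SURJECTIVE `2`-ADIC IMAGE — satisfiable (generic non-CM), excludes CM
and every non-maximal RZB label; its census coverage on X5's 763 good-ss classes is UNKNOWN (data ask D3
is load-bearing for «how much of row 1 C-E can ever touch»); `realPeriodRat` = the BSD-sharp period (on
`c_∞ = 2` rows one step sharper than an `Ω⁺`-normalised Euler-system bound); `q ≠ 0` forced by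
`L(E,1) ≠ 0`, `shaOrder` read under `Finite W.sha`. BC7 CLEAN. REF2: pending at filing (MEMO-es: Kato
17.4 at `2` exists up to `2ⁿ` and with image hypotheses; PR 4.8's local theory is odd-`p`).

WHAT IT BUYS (PROVED below, proofs copied from the sketch): `missingUpperBoundAt_two_of_katoRankZeroUpperBound`
— C-E ⇒ the typed UPPER Miller half `MissingUpperBoundAt W 2` in analytic rank `0` at a good
supersingular `2` (the `Upper` conjunct of the registered line's stub `stub_traceTwoMillerHalves`,
`a₂ = ±2`, 549 classes, and the rank-`0` content of `stub_zeroColemanKato`, `a₂ = 0`, 208 classes — with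
NO signed object and NO Coleman map at `2`); `tamagawa_odd_of_katoRankZeroUpperBound_of_unit` — C-E
contains ES-C-A(→)'s Tamagawa clause on the unit locus.

BC5 WITNESS (MEMO-es §3 T5, non-circular: engine-1 modular-symbol valuation vs Tate's algorithm):
`v₂ ∏c_ℓ ≤ v₂(L/Ω)` on **786/786** rank-`0` rows carrying engine-1's `v2_L_over_Om` (`a₂ = 0`: 594,
`−2`: 192; `pub/bsd-2adic/eng2/engine1.json` d8412f327e0740e5); equality on 353 rows (all `Ш_an = 1`,
63 with `c_∞ = 2`). CHEAPEST FALSIFIER: a rank-`0` good-ss row with `v₂∏c > v₂(L/Ω)` (0/786). WHY NOVEL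
(MEMO-es §0.3): the sign-free Kato upper bound with Tamagawa numbers at a supersingular `2` is not in
print (PR 2003 Prop. 4.8 / Kato Thm. 12.5(4), 17.4(3) are odd-`p`; Kato 17.4(1)(2) at `2` is up to `2ⁿ`).

References: [PerrinRiou2003] Prop. 4.8; [Kato2004Asterisque] Thm. 12.5, (12.5.2), Thm. 17.4;
HOME MEMO-es.md §§0.3, 3 T5; REF1-AUDIT-v1.md §1; [cite: Miller2011LMS, Def. 1.1].
-/

set_option autoImplicit false

noncomputable section

open scoped Classical

open WeierstrassCurve Literature.NumberTheory.EllipticCurves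
  Literature.NumberTheory.EllipticCurves.Rank1Residual
  Literature.NumberTheory.EllipticCurves.Rank1Residual.Typed
  Literature.NumberTheory.EllipticCurves.Wuthrich2014

namespace Summit.BirchSwinnertonDyer.Rank1Residual.F1Sign2

/-- **CANDIDATE ES-C-E `KatoRankZeroUpperBoundAtTwo` (OPEN; cell `bsd-f1-sign2`, lens `-es`) —
Perrin-Riou 2003 Prop. 4.8 (Kato) AT `p = 2`.** For `E/ℚ` (globally minimal) with good reduction at `2`,
`2 ∣ a₂` (all three supersingular traces), Kato's condition (12.5.2) at `2` (`Kato2004.ImageContainsSL2 W 2`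
= surjective `2`-adic image), `L(E,1) ≠ 0` and `Ш(E/ℚ)` finite: `L(E,1)/Ω_E` is a rational `q` with
`ord₂ #Ш + ord₂ ∏c_ℓ − 2·ord₂ #E(ℚ)_tors ≤ ord₂ q` (`Ω_E = realPeriodRat`, Tamagawa numbers INCLUDED,
no ♯/♭/± object). VERBATIM the tree's named fact `PerrinRiou2003.prop48_padicValRat_bsd_rank_zero_le` with
its binder `p ≠ 2` removed and `p := 2`. REF1: SURVIVES. Witness: `v₂∏c ≤ v₂(L/Ω)` on 786/786 rank-0 rows.
[cite: PerrinRiou2003, Prop. 4.8 (printed for odd `p`; the `p = 2` statement is NOT in print)] -/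
@[conjecture] def KatoRankZeroUpperBoundAtTwo : Prop :=
  ∀ (W : WeierstrassCurve ℚ) [W.IsElliptic] [W.IsGloballyMinimal],
    W.HasGoodReductionAtPrime 2 → (2 : ℤ) ∣ W.frobeniusTrace 2 →
    Kato2004.ImageContainsSL2 W 2 → W.entireLFunction 1 ≠ 0 → Finite W.sha →
    ∃ q : ℚ, W.entireLFunction 1 / (W.realPeriodRat : ℂ) = (q : ℂ) ∧
      (padicValNat 2 W.shaOrder : ℤ) + padicValNat 2 W.tamagawaProduct -
        2 * padicValNat 2 W.torsionOrder ≤ padicValRat 2 q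

/-- **C-E ⇒ the typed UPPER Miller half at `2`** (proof = `PerrinRiou2003.missingUpperBoundAt_of_prop48`
with `p := 2`): granted Gross–Zagier–Kolyvagin (`rank_eq_analyticRank_of_analyticRank_le_one`) and the
entire `L`-function (`hasEntireLFunction_rat`), at a good supersingular `2` with surjective `2`-adic image
and analytic rank `0`, `KatoRankZeroUpperBoundAtTwo` gives `MissingUpperBoundAt W 2`.
[cite: PerrinRiou2003, Prop. 4.8] [cite: Miller2011LMS, Def. 1.1] -/
theorem missingUpperBoundAt_two_of_katoRankZeroUpperBound (h : KatoRankZeroUpperBoundAtTwo)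
    (hGZK : rank_eq_analyticRank_of_analyticRank_le_one) (hmod : hasEntireLFunction_rat)
    (W : WeierstrassCurve ℚ) [W.IsElliptic] [W.IsGloballyMinimal]
    (hss : GoodSS W 2) (himg : Kato2004.ImageContainsSL2 W 2)
    (hr : W.analyticRank = 0) : MissingUpperBoundAt W 2 := by
  have hL : W.entireLFunction 1 ≠ 0 := (W.analyticRank_eq_zero_iff_holds (hmod W)).1 hr
  obtain ⟨hrank, hfin⟩ := hGZK W (by omega)
  obtain ⟨q, hq, hv⟩ := h W hss.1 hss.2 himg hL hfin
  obtain ⟨-, hE, -, hshaAn⟩ := shaAn_eq_of_L_one_div_eq hGZK W hL hq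
  haveI := hE
  have hq0 : q ≠ 0 := by
    rintro rfl
    apply hL
    have hΩ : (W.realPeriodRat : ℂ) ≠ 0 := by exact_mod_cast W.realPeriodRat_pos_holds.ne'
    have h0 := hq
    rw [Rat.cast_zero, div_eq_zero_iff] at h0
    exact h0.resolve_right hΩ
  have ht0 : 0 < W.torsionOrder := W.torsionOrder_pos_holds
  have hc0 : 0 < W.tamagawaProduct := W.tamagawaProduct_pos_holds
  refine ⟨_, hshaAn, ?_⟩
  have hcard : (Nat.card W.toAffine.Point : ℚ) = (W.torsionOrder : ℚ) := by
    exact_mod_cast (W.torsionOrder_eq_natCard_of_finite).symm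
  have ht : (W.torsionOrder : ℚ) ≠ 0 := by exact_mod_cast ht0.ne'
  have hc : (W.tamagawaProduct : ℚ) ≠ 0 := by exact_mod_cast hc0.ne'
  rw [hcard, padicValRat.div (mul_ne_zero hq0 (pow_ne_zero 2 ht)) hc,
    padicValRat.mul hq0 (pow_ne_zero 2 ht), padicValRat.pow (W.torsionOrder : ℚ), padicValRat.of_nat,
    padicValRat.of_nat]
  simp only [Nat.cast_ofNat]
  linarith

/-- **C-E contains ES-C-A(→)'s Tamagawa clause**: on the unit locus (`ord₂(L/Ω_E) = 0`) with `Ш` finite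
and surjective `2`-adic image it forces `2 ∤ ∏ c_ℓ` (torsion is odd at a good supersingular `2`: `E[2]`
irreducible, `P2.irr_two_of_goodSS_two`, + Mazur) — the 270/270 census law of MEMO-es §3 T1.
[cite: PerrinRiou2003, Prop. 4.8] -/
theorem tamagawa_odd_of_katoRankZeroUpperBound_of_unit (h : KatoRankZeroUpperBoundAtTwo)
    (W : WeierstrassCurve ℚ) [W.IsElliptic] [W.IsGloballyMinimal]
    (hss : GoodSS W 2) (himg : Kato2004.ImageContainsSL2 W 2) (hfin : Finite W.sha)
    (hu : UnitLValueAtTwo W) : ¬ 2 ∣ W.tamagawaProduct := by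
  obtain ⟨t, ht, ht0, hvt⟩ := hu
  have hL : W.entireLFunction 1 ≠ 0 := by
    intro h0
    have : (t : ℂ) = 0 := by rw [← ht, h0, zero_div]
    exact ht0 (by exact_mod_cast this)
  obtain ⟨q, hq, hv⟩ := h W hss.1 hss.2 himg hL hfin
  have hqt : q = t := by
    have : (q : ℂ) = (t : ℂ) := by rw [← hq, ht]
    exact_mod_cast this
  subst hqt
  rw [hvt] at hv
  intro hdvd
  have hc0 : 0 < W.tamagawaProduct := W.tamagawaProduct_pos_holds
  have h1 : 1 ≤ padicValNat 2 W.tamagawaProduct :=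
    (padicValNat_dvd_iff_le hc0.ne').1 (by simpa using hdvd)
  have htors : ¬ 2 ∣ W.torsionOrder := fun hd =>
    not_hasIrreducibleModPGaloisRep_of_dvd_torsionOrder W 2 hd (P2.irr_two_of_goodSS_two W hss)
  have htv : padicValNat 2 W.torsionOrder = 0 := padicValNat.eq_zero_of_not_dvd htors
  rw [htv] at hv
  simp only [Nat.cast_zero, mul_zero, sub_zero] at hv
  omega

end Summit.BirchSwinnertonDyer.Rank1Residual.F1Sign2

end
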